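import Summits.CriticalPhenomena.CardyFormulaZ2.Theorems.CardySelfRefinementDefs
import Summits.CriticalPhenomena.CardyFormulaZ2.Theorems.CardySelfRefinementTrivialSectorRateStubFourArmAboveOneTwoArmsLocality
import Summits.CriticalPhenomena.CardyFormulaZ2.Theorems.CardySelfRefinementTrivialSectorRateStubFourArmAboveOneCircuits
import Literature.Probability.Percolation.CrossingClusterBlockEstimate
import Literature.Probability.Percolation.SelfRefinementMeasure
import HarnessLib

/-!
# Stub `openArm_decay_along` of line `far-field-is-a-quarter-turn` (crux `TrivialSectorRate`,
stmt-CriticalPhenomena-10266): THE PRIMAL ONE-ARM DECAY ALONG AN RSW PATH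

Input `1/2` of the corner bound of the open stub `stub_boundaryRelevance`: polynomial decay,
uniformly along an admissible RSW path `γ` (`PathOK k γ`, `k = 2, 3`), of the probability under
`M_k(γ s)` of an OPEN ARM from a site of `c + B(m-1)` to a site outside `c + B(n)`, in the exact
set-builder form
`{ω | ∃ u w (q : Walk u w), u - c ∈ B(m-1) ∧ w - c ∉ B(n) ∧ ∀ e ∈ q.edges, e ∈ ω}`
(the first conjunct of Garban's two-arm event `openDualArmsAt c m (n+1)`,
`FourArmGarbanTwoArms.lean`).

Proof = the primal mirror image of `dualArm_decay_along` (file `…StubSixArmDecayDualArm.lean`),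
with closed DUAL circuits blocking the OPEN arm, exactly as in the two-arm decay (M3)
(`real_openDualArmsAt_le_pow`, file `…StubFourArmAboveOneTwoArmsLocality.lean`):

* `real_openArm_le_real_biInter` — an open lattice walk from `c + B(m-1)` to the outside of
  `c + B(n)` excludes a closed dual circuit of every dual annulus `(c-1) + A_{aᵢ,bᵢ}`,
  `m ≤ aᵢ ≤ bᵢ ≤ n` (the tree's `not_mem_dualCircuitInAnnulusAt_of_openWalk`; `M_k` is carried by
  lattice configurations, `selfRefinementMeasure_ae_subset_edgeSet`), so
  `M_k(open arm across c + A_{m,n}) ≤ M_k(⋂ᵢ (dualCircuitInAnnulusAt (c-1) aᵢ bᵢ)ᶜ)`;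
* `real_biInter_compl_dualCircuitInAnnulusAt_eq_prod` (tree) — for `k`-separated annuli these
  complements are independent under the coin product structure of `M_k`;
* `real_openArm_le_pow` — with geometric annuli `aᵢ = 4ⁱ m`, `bᵢ = 2aᵢ` and a uniform closed
  dual-circuit bound `M_k(dualCircuitInAnnulusAt c' a b) ≥ 1 - q` for thin annuli, the open arm
  costs `q^J`;
* **`openArm_decay_along`** (the registered stub) — along `PathOK k γ` the closed dual circuits
  have probability `≥ ρ₄` (`circuitsAlong`, aspect ratio `4`), so the open arm has probability
  `≤ 2^a (m/n)^a`, `a = log_{1/4} max(1 - ρ₄, 1/4) > 0`, for `m ≥ max a₀ 2`, uniformly in `s`, `c`.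

References: H. Kesten, *Percolation theory for mathematicians* (1982), §2; G. Grimmett,
*Percolation* (1999), §11.2, §11.7 (11.78); O. Schramm, S. Smirnov (app. C. Garban), Ann. Probab.
39 (2011), App. B, (B.6).

Target file:
`Summits/CriticalPhenomena/CardyFormulaZ2/Theorems/CardySelfRefinementTrivialSectorRateStubBoundaryRelevanceOpenArm.lean`.
-/

noncomputable section

namespace Summit.CriticalPhenomena.CardyFormulaZ2.Theorems.CardySelfRefinement.FarField

open Set MeasureTheory
open Literature.Probability.LatticeModels Literature.Probability.Percolation
open Literature.Probability.Percolation.QuadCrossing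
open Summit.CriticalPhenomena.CardyFormulaZ2.Theses.CardySelfRefinement

/-! ### The open arm excludes closed dual circuits in all intermediate annuli -/

/-- **An open arm crosses every intermediate dual annulus.**  For radii `1 ≤ aᵢ`,
`m ≤ aᵢ ≤ bᵢ ≤ n` (`i ∈ s`): the open lattice walk from a site of `c + B(m-1) ⊆ (c-1) + 1 + B(aᵢ-1)`
to a site outside `c + B(n) ⊇ (c-1) + 1 + B(bᵢ)` excludes a closed dual circuit of the dual
annulus `(c-1) + A_{aᵢ,bᵢ}` (`not_mem_dualCircuitInAnnulusAt_of_openWalk`; an `M_k`-a.e.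
configuration is a lattice configuration), so
`M_k(open arm across c + A_{m,n}) ≤ M_k(⋂ᵢ (dualCircuitInAnnulusAt (c-1) aᵢ bᵢ)ᶜ)`. -/
theorem real_openArm_le_real_biInter (k : ℕ) (ρ c₀ : ℝ) (c : Site 2) (m n : ℕ)
    (s : Finset ℕ) (a b : ℕ → ℕ) (h : ∀ i ∈ s, 1 ≤ a i ∧ m ≤ a i ∧ a i ≤ b i ∧ b i ≤ n) :
    (M k ρ c₀).real {ω | ∃ (u w : Site 2) (q : (zdGraph 2).Walk u w),
        u - c ∈ box 2 (m - 1) ∧ w - c ∉ box 2 n ∧ ∀ e ∈ q.edges, e ∈ ω} ≤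
      (M k ρ c₀).real (⋂ i ∈ s, (dualCircuitInAnnulusAt (c - 1) (a i) (b i))ᶜ) := by
  refine ENNReal.toReal_mono (measure_ne_top _ _) (measure_mono_ae ?_)
  have hae : ∀ᵐ ω ∂(M k ρ c₀), ω ⊆ (zdGraph 2).edgeSet :=
    selfRefinementMeasure_ae_subset_edgeSet k ρ c₀
  filter_upwards [hae] with ω hω hO
  obtain ⟨u, w, p, hu, hw, hp⟩ := hO
  refine Set.mem_iInter₂.2 fun i hi => ?_
  obtain ⟨h1, h2, h3, h4⟩ := h i hi
  refine not_mem_dualCircuitInAnnulusAt_of_openWalk h1 h3 hω p hp ?_ ?_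
  · rw [show u - (c - 1) - 1 = u - c by abel]
    exact box_mono 2 (by omega) hu
  · rw [show w - (c - 1) - 1 = w - c by abel]
    exact fun hw' => hw (box_mono 2 h4 hw')

/-- **Geometric annuli: the open arm costs `q^J`.**  If every thin annulus `c' + A_{a,b}` with
`a₀ ≤ a < b`, `2b ≤ 4(b - a)` carries a closed dual circuit around `c'` with
`M_k(ρ,c₀)`-probability `≥ 1 - q`, then for `m ≥ max(a₀, 2)` and `J` annuli
`(c-1) + A_{4ⁱm, 2·4ⁱm}`, `i < J`, inside radius `n`, the open arm across `c + A_{m,n}` has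
probability at most `q ^ J` (`k ≤ 3 < 2m` makes consecutive annuli `k`-separated; the primal
mirror image of `real_dualArm_le_pow`, cf. `real_openDualArmsAt_le_pow`). -/
theorem real_openArm_le_pow {k : ℕ} (hk0 : 0 < k) (hk3 : k ≤ 3) (ρ c₀ : ℝ) {q : ℝ}
    {a₀ : ℕ} (hcirc : ∀ (c' : Site 2) (a b : ℕ), a₀ ≤ a → a < b → 2 * b ≤ 4 * (b - a) →
      1 - q ≤ (M k ρ c₀).real (dualCircuitInAnnulusAt c' a b))
    (c : Site 2) {m n J : ℕ} (hm0 : a₀ ≤ m) (hm2 : 2 ≤ m)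
    (hJ : ∀ i < J, 2 * (4 ^ i * m) ≤ n) :
    (M k ρ c₀).real {ω | ∃ (u w : Site 2) (q : (zdGraph 2).Walk u w),
        u - c ∈ box 2 (m - 1) ∧ w - c ∉ box 2 n ∧ ∀ e ∈ q.edges, e ∈ ω} ≤ q ^ J := by
  haveI := isProbabilityMeasure_M k ρ c₀
  have hpow : ∀ i : ℕ, m ≤ 4 ^ i * m := fun i =>
    Nat.le_mul_of_pos_left m (Nat.one_le_pow _ _ (by norm_num))
  have hgeom : ∀ i ∈ Finset.range J, 1 ≤ 4 ^ i * m ∧ m ≤ 4 ^ i * m ∧ 4 ^ i * m ≤ 2 * (4 ^ i * m) ∧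
      2 * (4 ^ i * m) ≤ n := by
    intro i hi
    have h2 := hpow i
    have h3 := hJ i (Finset.mem_range.1 hi)
    omega
  have hfar : ∀ i ∈ Finset.range J, ∀ j ∈ Finset.range J, i < j →
      2 * (4 ^ i * m) + k ≤ 4 ^ j * m := by
    intro i _ j _ hij
    have h1 : 4 ^ (i + 1) ≤ 4 ^ j := Nat.pow_le_pow_right (by norm_num) hij
    have h2 : 4 ^ (i + 1) * m ≤ 4 ^ j * m := Nat.mul_le_mul_right m h1
    have h3 : 4 ^ (i + 1) * m = 4 * (4 ^ i * m) := by ring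
    have h4 := hpow i
    omega
  have hq : ∀ i ∈ Finset.range J,
      1 - (M k ρ c₀).real (dualCircuitInAnnulusAt (c - 1) (4 ^ i * m) (2 * (4 ^ i * m))) ≤ q := by
    intro i _
    have h4 := hpow i
    have := hcirc (c - 1) (4 ^ i * m) (2 * (4 ^ i * m)) (by omega) (by omega) (by omega)
    linarith
  calc (M k ρ c₀).real {ω | ∃ (u w : Site 2) (q : (zdGraph 2).Walk u w),
          u - c ∈ box 2 (m - 1) ∧ w - c ∉ box 2 n ∧ ∀ e ∈ q.edges, e ∈ ω}
      ≤ (M k ρ c₀).real (⋂ i ∈ Finset.range J,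
          (dualCircuitInAnnulusAt (c - 1) (4 ^ i * m) (2 * (4 ^ i * m)))ᶜ) :=
        real_openArm_le_real_biInter k ρ c₀ c m n (Finset.range J) (fun i => 4 ^ i * m)
          (fun i => 2 * (4 ^ i * m)) hgeom
    _ = ∏ i ∈ Finset.range J,
          (1 - (M k ρ c₀).real (dualCircuitInAnnulusAt (c - 1) (4 ^ i * m) (2 * (4 ^ i * m)))) :=
        real_biInter_compl_dualCircuitInAnnulusAt_eq_prod hk0 ρ c₀ (c - 1) (Finset.range J)
          (fun i => 4 ^ i * m) (fun i => 2 * (4 ^ i * m)) hfar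
    _ ≤ ∏ _i ∈ Finset.range J, q :=
        Finset.prod_le_prod (fun i _ => sub_nonneg.2 measureReal_le_one) hq
    _ = q ^ J := by rw [Finset.prod_const, Finset.card_range]

/-! ### The registered stub: primal one-arm decay along the path -/

/-- **Primal one-arm decay along an RSW path** (registered stub `openArm_decay_along` of the line
`far-field-is-a-quarter-turn`; input of the corner bound of `stub_boundaryRelevance`).  For
`PathOK k γ`, `k = 2, 3`, there are `c', a > 0` and `m₀` such that for all `s`, every centre `c`
and all radii `m₀ ≤ m ≤ n`, the `M_k(γ s)`-probability of an open arm from a site of `c + B(m-1)`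
to a site outside `c + B(n)` is at most `c' (m/n)^a`: the open arm crosses `J ≍ log₄(n/m)`
disjoint `k`-separated geometric dual annuli, in each of which (M1) (`circuitsAlong`, aspect
ratio `4`) puts a CLOSED DUAL circuit with probability `≥ ρ₄` independently of the others (coin
product structure of `M_k`), whence the bound `(1 - ρ₄)^J ≤ 2^a (m/n)^a` with
`a = log_{1/4} max(1 - ρ₄, 1/4)` (Kesten 1982 §2; Grimmett 1999 §11.7 (11.78), run for the
dependent model `M_k`). -/
theorem openArm_decay_along {k : ℕ} (hk : k = 2 ∨ k = 3) {γ : unitInterval → ℝ × ℝ}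
    (hγ : PathOK k γ) :
    ∃ c' a : ℝ, 0 < c' ∧ 0 < a ∧ ∃ m₀ : ℕ, ∀ (s : unitInterval) (c : Site 2) (m n : ℕ),
      m₀ ≤ m → m ≤ n →
        (M k (γ s).1 (γ s).2).real {ω | ∃ (u w : Site 2) (q : (zdGraph 2).Walk u w),
          u - c ∈ box 2 (m - 1) ∧ w - c ∉ box 2 n ∧ ∀ e ∈ q.edges, e ∈ ω} ≤
          c' * ((m : ℝ) / n) ^ a := by
  have hk0 : 0 < k := by rcases hk with rfl | rfl <;> norm_num
  have hk3 : k ≤ 3 := by rcases hk with rfl | rfl <;> norm_num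
  obtain ⟨ρs, hρs, a₀, hcirc⟩ := circuitsAlong hk hγ (K := 4) (by norm_num)
  -- the decay rate
  set q : ℝ := max (1 - ρs) (1 / 4) with hq
  have hq0 : 0 < q := lt_of_lt_of_le (by norm_num) (le_max_right _ _)
  have hq1 : q < 1 := max_lt (by linarith) (by norm_num)
  have h14 : (0 : ℝ) ≤ 1 / 4 := by norm_num
  set α : ℝ := Real.logb (1 / 4) q with hα
  have hα0 : 0 < α := Real.logb_pos_of_base_lt_one (by norm_num) (by norm_num) hq0 hq1
  have hqα : (1 / 4 : ℝ) ^ α = q := Real.rpow_logb (by norm_num) (by norm_num) hq0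
  refine ⟨(2 : ℝ) ^ α, α, by positivity, hα0, max a₀ 2, fun s c m n hm hmn => ?_⟩
  have hm0 : a₀ ≤ m := (le_max_left _ _).trans hm
  have hm2 : 2 ≤ m := (le_max_right _ _).trans hm
  -- the number `J` of geometric annuli between `m` and `n`
  obtain ⟨J, hJ1, hJ2⟩ : ∃ J : ℕ, (∀ i < J, 2 * (4 ^ i * m) ≤ n) ∧ n < 2 * (4 ^ J * m) := by
    refine ⟨Nat.clog 4 (n / (2 * m) + 1), fun i hi => ?_, ?_⟩
    · have h4 : 4 ^ i < n / (2 * m) + 1 := (Nat.lt_clog_iff_pow_lt (by norm_num)).1 hi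
      have h5 : 4 ^ i * (2 * m) ≤ n / (2 * m) * (2 * m) :=
        Nat.mul_le_mul_right (2 * m) (Nat.lt_succ_iff.1 h4)
      have h6 : n / (2 * m) * (2 * m) ≤ n := Nat.div_mul_le_self _ _
      have e1 : 4 ^ i * (2 * m) = 2 * (4 ^ i * m) := by ring
      omega
    · have h4 : n / (2 * m) + 1 ≤ 4 ^ Nat.clog 4 (n / (2 * m) + 1) :=
        Nat.le_pow_clog (by norm_num) _
      have h5 : n < n / (2 * m) * (2 * m) + 2 * m := Nat.lt_div_mul_add (by omega)
      have h6 : (n / (2 * m) + 1) * (2 * m) ≤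
          4 ^ Nat.clog 4 (n / (2 * m) + 1) * (2 * m) := Nat.mul_le_mul_right (2 * m) h4
      have e2 : (n / (2 * m) + 1) * (2 * m) = n / (2 * m) * (2 * m) + 2 * m := by
        ring
      have e3 : 4 ^ Nat.clog 4 (n / (2 * m) + 1) * (2 * m) =
          2 * (4 ^ Nat.clog 4 (n / (2 * m) + 1) * m) := by ring
      omega
  -- the probability bound `q ^ J`
  have hP : (M k (γ s).1 (γ s).2).real {ω | ∃ (u w : Site 2) (q : (zdGraph 2).Walk u w),
      u - c ∈ box 2 (m - 1) ∧ w - c ∉ box 2 n ∧ ∀ e ∈ q.edges, e ∈ ω} ≤ q ^ J :=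
    real_openArm_le_pow hk0 hk3 (γ s).1 (γ s).2 (q := q) (a₀ := a₀)
      (fun c' a b h1 h2 h3 => by
        have := (hcirc s c' a b h1 h2 h3).2
        linarith [le_max_left (1 - ρs) (1 / 4 : ℝ)])
      c hm0 hm2 hJ1
  -- arithmetic: `q ^ J = ((1/4)^J)^α ≤ (2 m / n)^α`
  have hn0 : (0 : ℝ) < n := by exact_mod_cast (show 0 < n by omega)
  have h4J : (0 : ℝ) < (4 : ℝ) ^ J := by positivity
  have hratio : ((1 : ℝ) / 4) ^ J ≤ 2 * ((m : ℝ) / n) := by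
    rw [one_div_pow, div_le_iff₀ h4J,
      show 2 * ((m : ℝ) / n) * 4 ^ J = 2 * (4 ^ J * m) / n by ring, le_div_iff₀ hn0, one_mul]
    exact_mod_cast hJ2.le
  calc (M k (γ s).1 (γ s).2).real {ω | ∃ (u w : Site 2) (q : (zdGraph 2).Walk u w),
          u - c ∈ box 2 (m - 1) ∧ w - c ∉ box 2 n ∧ ∀ e ∈ q.edges, e ∈ ω}
        ≤ q ^ J := hP
    _ = (((1 : ℝ) / 4) ^ J) ^ α := by rw [← hqα, Real.rpow_pow_comm h14]
    _ ≤ (2 * ((m : ℝ) / n)) ^ α := Real.rpow_le_rpow (by positivity) hratio hα0.le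
    _ = (2 : ℝ) ^ α * ((m : ℝ) / n) ^ α := Real.mul_rpow (by norm_num) (by positivity)

end Summit.CriticalPhenomena.CardyFormulaZ2.Theorems.CardySelfRefinement.FarField

end
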